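import Literature.Probability.Percolation.HalfPlaneOneArmQuasiMultiplicativity
import Literature.Probability.Percolation.HalfAnnulusQuadLatticeShadow
import HarnessLib

/-!
# The half-plane one-arm probability is quasi-multiplicative with quad-crossing blocks (bond `ℤ²`)

Topic `Literature/Probability/Percolation`; proofs only (no definition, no named fact). This file
combines the quasi-multiplicativity / extendability of the half-plane one-arm probability
(`HalfPlaneOneArmQuasiMultiplicativity.lean`, Nolin 2008 §4.5–4.6) with the dictionary between
lattice half-annulus crossings and the Schramm–Smirnov crossing event of a half-annulus quad
(`HalfAnnulusQuadLatticeCrossing.lean`, `HalfAnnulusQuadLatticeShadow.lean`), in the abstract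
integer coordinates `X, Y` of `ℤ²` (local notation as in those files), into the two statements
consumed by the orientation transfer of the crux `HalfPlaneOneArmThird` (`CardyFormulaZ2`):

* `quadCrossingProb_ge` — the crossing probability of the half-annulus quad of modulus `L` by the
  lattice at sup-radius `ρ` is `≥ c(L) > 0`, uniformly in the scale (RSW);
* `arm_quadCrossing_chain` — **two-sided quasi-multiplicativity with the quad-crossing
  probabilities as blocks**: `P(arm[x₀, F']) ≤ C · P(arm[x₀, F]) · P[𝒞_δ(R)]` and
  `P(arm[x₀, F]) · P[𝒞_δ(R)] ≤ C · P(arm[x₀, F'])` for consecutive scales `F ≤ ρ < F + 1`,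
  `F' ≤ L ρ < F' + 1`, `L F ≤ F' ≤ L F + L`, with `C` INDEPENDENT of `L` and of the scale — so that
  `log P(arm[x₀, ·])` along `L^k` is the sum of the `log P[𝒞(·)]` up to `O(1)` per step
  (P. Nolin, EJP 13 (2008), §4.5, Props. 12–13; §4.7).

## References

* P. Nolin, *Near-critical percolation in two dimensions*, EJP 13 (2008), §4.5–4.7. [Nolin2008]
* O. Schramm, S. Smirnov, Ann. Probab. 39 (2011), §1.3. [SchrammSmirnov2011]
-/

noncomputable section

namespace Literature.Probability.Percolation

open MeasureTheory Set LatticeModels Complex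
open Literature.Probability.RandomPlanarGeometry

namespace HalfPlaneArm

variable {F : Type*} {emb : RhombicEmbedding (zdGraph 2) F} {κ : ℝ} {X Y : Site 2 → ℤ}

local notation3 "ν[" b ", " v "]" => max |X v - X b| (Y v - Y b)
local notation3 "box[" A₁ ", " A₂ ", " B₁ ", " B₂ "]" =>
  {v : Site 2 | A₁ ≤ X v ∧ X v ≤ A₂ ∧ B₁ ≤ Y v ∧ Y v ≤ B₂}
local notation3 "LR[" A₁ ", " A₂ ", " B₁ ", " B₂ "]" =>
  openCrossing box[A₁, A₂, B₁, B₂] {v : Site 2 | X v = A₁} {v : Site 2 | X v = A₂}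
local notation3 "TB[" A₁ ", " A₂ ", " B₁ ", " B₂ "]" =>
  openCrossing box[A₁, A₂, B₁, B₂] {v : Site 2 | Y v = B₁} {v : Site 2 | Y v = B₂}
local notation3 "LRf[" A ", " B ", " w ", " h "]" =>
  openCrossing {v : Site 2 | A - 2 ≤ X v ∧ X v ≤ A + w + 2 ∧ B ≤ Y v ∧ Y v ≤ B + h}
    {v : Site 2 | X v ≤ A} {v : Site 2 | A + w ≤ X v}
local notation3 "TBf[" A ", " B ", " w ", " h "]" =>
  openCrossing {v : Site 2 | A ≤ X v ∧ X v ≤ A + w ∧ B - 2 ≤ Y v ∧ Y v ≤ B + h + 2}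
    {v : Site 2 | Y v ≤ B} {v : Site 2 | B + h ≤ Y v}
local notation3 "ann[" b ", " r ", " R "]" =>
  {v : Site 2 | 0 ≤ Y v ∧ r ≤ ν[b, v] ∧ ν[b, v] ≤ R}
local notation3 "E[" b ", " r ", " R "]" =>
  openCrossing ann[b, r, R] {v : Site 2 | ν[b, v] = r} {v : Site 2 | ν[b, v] = R}
local notation3 "Ubox[" b ", " a "]" => box[X b - 2 * a, X b + 2 * a, 0, Y b + 2 * a]
local notation3 "U[" b ", " a "]" =>
  TB[X b + a, X b + 2 * a, 0, Y b + 2 * a] ∩ LR[X b - 2 * a, X b + 2 * a, Y b + a, Y b + 2 * a] ∩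
    TB[X b - 2 * a, X b - a, 0, Y b + 2 * a]
local notation3 "μ[" p "]" => bondPercolation (zdGraph 2) p
local notation3 "RSW_LR[" p "]" => ∀ k : ℕ, 2 ≤ k → ∃ c : ℝ, 0 < c ∧ ∃ m₀ : ℕ, ∀ m : ℕ, m₀ ≤ m →
  ∀ A B : ℤ, c ≤ (bondPercolation (zdGraph 2) p).real LRf[A, B, (k : ℤ) * m, (m : ℤ)]
local notation3 "RSW_TB[" p "]" => ∀ k : ℕ, 2 ≤ k → ∃ c : ℝ, 0 < c ∧ ∃ m₀ : ℕ, ∀ m : ℕ, m₀ ≤ m →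
  ∀ A B : ℤ, c ≤ (bondPercolation (zdGraph 2) p).real TBf[A, B, (m : ℤ), (k : ℤ) * m]
local notation3 "armbox[" x ", " n "]" => {v : Site 2 | 0 ≤ Y v ∧ ν[x, v] ≤ n}
local notation3 "arm[" x ", " n "]" => openCrossing armbox[x, n] {x} {v : Site 2 | ν[x, v] = n}
local notation3 "ν₀[" v "]" => max |X v| (Y v)
local notation3 "ann₀[" r ", " R "]" => {v : Site 2 | 0 ≤ Y v ∧ r ≤ ν₀[v] ∧ ν₀[v] ≤ R}
local notation3 "E₀[" r ", " R "]" =>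
  openCrossing ann₀[r, R] {v : Site 2 | ν₀[v] = r} {v : Site 2 | ν₀[v] = R}
local notation3 "pt[" v "]" => ((X v : ℂ) + (Y v : ℂ) * Complex.I)
/-- The sup-norm of a complex number (local). -/
local notation3 "sn[" w "]" => max |Complex.re w| |Complex.im w|
local notation3 "Hann[" L "]" => {w : ℂ | 0 ≤ w.im ∧ 1 ≤ sn[w] ∧ sn[w] ≤ L}
local notation3 "Iarc" => {w : ℂ | 0 ≤ w.im ∧ sn[w] = 1}
local notation3 "Oarc[" L "]" => {w : ℂ | 0 ≤ w.im ∧ sn[w] = L}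


/-! ### The two-sided chain inequality against the quad-crossing probability -/

section Chain

variable (hX : ∀ u v, (zdGraph 2).Adj u v → X v ≤ X u + 1) (hY : ∀ u v, (zdGraph 2).Adj u v → Y v ≤ Y u + 1)
  (hInj : Function.Injective fun v : Site 2 => (X v, Y v))
  (hiso : emb.IsIsoradial) (hrh : emb.IsRhombicTiling) (hκ : 0 < κ)
  (hre : ∀ v, (emb.z v).re = κ * X v) (him : ∀ v, (emb.z v).im = κ * Y v)

include hX in
/-- **The quad-crossing probability of the half-annulus of modulus `L` is bounded below**, uniformly
in the scale: if the lattice (drawn by `meshPoint δ v = c (X v + i Y v) / ρ`) sees the quad `R` as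
`c · {0 ≤ im, 1 ≤ ‖·‖_∞ ≤ L}` with sides `0`, `2` the inner/outer half-squares, and `F ≤ ρ`,
`L ρ < F' + 1`, `F' ≤ L F + L`, then `P[𝒞_δ(R)] ≥ P(E[z₀, F, F' + 1]) ≥ c(L) > 0` (a lattice crossing
of the wider half-annulus crosses the quad; RSW). [cite: Nolin2008, §4.6 with §4.3 (RSW in the half-plane)] -/
theorem quadCrossingProb_ge (rswLR : RSW_LR[half]) (L : ℕ) (hL : 2 ≤ L) :
    ∃ c : ℝ, 0 < c ∧ ∃ m₀ : ℕ, ∀ (z₀ : Site 2), X z₀ = 0 → Y z₀ = 0 →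
      ∀ (R : ConformalRectangle) (c' : ℂ) (δ ρ : ℝ), c' ≠ 0 → 0 < ρ → 0 < δ →
        closure R.carrier = (fun w => c' * w) '' Hann[L] → R.arc 0 = (fun w => c' * w) '' Iarc →
        R.arc 2 = (fun w => c' * w) '' Oarc[L] → (∀ v : Site 2, meshPoint δ v = c' * pt[v] / ρ) →
      ∀ (F F' : ℤ), (m₀ : ℤ) ≤ F → F' ≤ L * F + L → L * F ≤ F' → (F : ℝ) ≤ ρ → (L : ℝ) * ρ < F' + 1 →
        c ≤ quadCrossingProb δ R := by
  obtain ⟨c, hc, m₀, h⟩ := crossing_lower hX half rswLR (2 * L)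
  refine ⟨c, hc, m₀ + 2, fun z₀ hzX hzY R c' δ ρ hc' hρ hδ hcl h0 h2 hmesh F F' hF hF' hLF hFρ hρF' => ?_⟩
  have hL1 : (1 : ℝ) ≤ L := by exact_mod_cast (show 1 ≤ L by omega)
  have hF2 : 2 ≤ F := by push_cast at hF; omega
  have f1 : F ≤ (L : ℤ) * F := le_mul_of_one_le_left (by omega) (by exact_mod_cast (show 1 ≤ L by omega))
  have f2 : (L : ℤ) * 2 ≤ (L : ℤ) * F := mul_le_mul_of_nonneg_left hF2 (by positivity)
  have f3 : F' + 1 - F ≤ 2 * ((L : ℤ) * F) := by omega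
  have key := h z₀ F (F' + 1) (by rw [hzY]) (by push_cast at hF ⊢; omega) (by omega) (by push_cast; linarith)
  refine key.trans ?_
  have e : E[z₀, F, F' + 1] = E₀[F, F' + 1] := by simp only [hzX, hzY, sub_zero]
  rw [e]
  exact real_latticeCrossing_le_quadCrossingProb hc' hρ hδ hL1 hcl h0 h2 hmesh hFρ
    (by push_cast; linarith) (by omega)

include hX hY hInj hiso hrh hκ hre him in
/-- **The half-plane one-arm probability is quasi-multiplicative with the quad-crossing
probabilities as blocks.** There are `C ≥ 1` and `m₀` (depending only on the orientation data and the
RSW constants) such that for every modulus `L ≥ 8`, every base point `x₀` of the boundary strip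
(`0 ≤ Y x₀ ≤ 1`) within one unit of a block centre `z₀` with `X z₀ = Y z₀ = 0`, every quad `R` seen
by the lattice drawn at mesh `δ` as `c · {0 ≤ im, 1 ≤ ‖·‖_∞ ≤ L}` at sup-radius `ρ` (sides `0`, `2` =
inner/outer half-squares, pulled-back edges shorter than `2`), and all integer scales
`m₀ ≤ F ≤ ρ < F + 1`, `L F ≤ F' ≤ L F + L`, `F' ≤ L ρ < F' + 1`:
`P(arm[x₀, F']) ≤ C · P(arm[x₀, F]) · P[𝒞_δ(R)]` and `P(arm[x₀, F]) · P[𝒞_δ(R)] ≤ C · P(arm[x₀, F'])`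
(quasi-multiplicativity `real_arm_le_mul` / `real_arm_ge_mul`, extendability `real_arm_extend` /
`crossing_extend`, and the dictionary `real_latticeCrossing_le_quadCrossingProb` /
`quadCrossingProb_le_real_latticeCrossing`). [cite: Nolin2008, §4.5, Props. 12–13 (arXiv 0711.4948: Props. 11–12), with §4.6] -/
theorem arm_quadCrossing_chain (rswLR : RSW_LR[half]) (rswTB : RSW_TB[half])
    (τ : zdGraph 2 ≃g zdGraph 2) {tX : ℤ} (htX : |tX| ≤ 1) (hτX : ∀ v, X (τ v) = X v + tX)
    (hτY : ∀ v, Y (τ v) = Y v + 1) :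
    ∃ C : ℝ, 1 ≤ C ∧ ∃ m₀ : ℕ, ∀ (L : ℕ), 8 ≤ L → ∀ (x₀ z₀ : Site 2), 0 ≤ Y x₀ → Y x₀ ≤ 1 →
      X z₀ = 0 → Y z₀ = 0 → |X x₀ - X z₀| ≤ 1 → |Y x₀ - Y z₀| ≤ 1 →
      ∀ (R : ConformalRectangle) (c : ℂ) (δ ρ : ℝ), c ≠ 0 → 0 < ρ → 0 < δ → ρ * δ < 2 * ‖c‖ →
        closure R.carrier = (fun w => c * w) '' Hann[L] → R.arc 0 = (fun w => c * w) '' Iarc →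
        R.arc 2 = (fun w => c * w) '' Oarc[L] → (∀ v : Site 2, meshPoint δ v = c * pt[v] / ρ) →
      ∀ (F F' : ℤ), (m₀ : ℤ) ≤ F → L * F ≤ F' → F' ≤ L * F + L → (F : ℝ) ≤ ρ → ρ < F + 1 →
        (F' : ℝ) ≤ L * ρ → (L : ℝ) * ρ < F' + 1 →
        (μ[half]).real arm[x₀, F'] ≤ C * (μ[half]).real arm[x₀, F] * quadCrossingProb δ R ∧
        (μ[half]).real arm[x₀, F] * quadCrossingProb δ R ≤ C * (μ[half]).real arm[x₀, F'] := by
  obtain ⟨ce, hce, me, hext⟩ := crossing_extend hX hY hInj hiso hrh hκ hre him half rswLR rswTB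
  obtain ⟨ca, hca, ma, hglue⟩ := real_arm_ge_mul hX hY hInj hiso hrh hκ hre him half rswLR rswTB
  obtain ⟨cx, hcx, mx, hxt⟩ := real_arm_extend hX hY hInj hiso hrh hκ hre him half rswLR rswTB
  refine ⟨max 1 (max (1 / ce) (1 / (ce * cx * ca))), le_max_left _ _, me + ma + mx + 4,
    fun L hL x₀ z₀ hx₀ hx₁ hzX hzY hcX hcY R c δ ρ hc hρ hδ hκ' hcl h0 h2 hmesh F F' hF hLF hF' hFρ hρF hF'ρ hρF' => ?_⟩
  have hL1 : (1 : ℝ) ≤ L := by exact_mod_cast (show 1 ≤ L by omega)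
  have hF4 : 4 ≤ F := by push_cast at hF; omega
  have hF'8 : 8 * F ≤ F' := le_trans (mul_le_mul_of_nonneg_right (by exact_mod_cast hL) (by omega)) hLF
  have hE : ∀ r R : ℤ, E[z₀, r, R] = E₀[r, R] := fun r R => by simp only [hzX, hzY, sub_zero]
  have hzY0 : 0 ≤ Y z₀ := by rw [hzY]
  -- the two dictionary inequalities
  have sa : (μ[half]).real E[z₀, F, F' + 1] ≤ quadCrossingProb δ R := by
    rw [hE]
    exact real_latticeCrossing_le_quadCrossingProb hc hρ hδ hL1 hcl h0 h2 hmesh hFρ (by push_cast; linarith)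
      (by omega)
  have sb : quadCrossingProb δ R ≤ (μ[half]).real E[z₀, F + 4, F' - 3] := by
    rw [hE]
    exact quadCrossingProb_le_real_latticeCrossing hX hY hc hρ hδ hκ' hcl h0 h2 hmesh τ htX hτX hτY
      (by push_cast; linarith) (by omega) (by push_cast; linarith)
  -- extendability of the blocks
  have ext1 : ce * (μ[half]).real E[z₀, F + 2, F' - 1] ≤ (μ[half]).real E[z₀, F, F' + 1] :=
    hext z₀ F (F + 2) (F' - 1) (F' + 1) (F + 2) ((F' + 4) / 4) hzY0 (by push_cast at hF ⊢; omega) (by omega)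
      le_rfl (by omega) (by omega) (by rw [hzY]; omega) (by omega) (by rw [hzY]; omega) (by omega) (by omega)
      (by omega)
  have ext2 : ce * (μ[half]).real E[z₀, F + 4, F' - 3] ≤ (μ[half]).real E[z₀, F, F' + 1] :=
    hext z₀ F (F + 4) (F' - 3) (F' + 1) (F + 4) ((F' + 4) / 4) hzY0 (by push_cast at hF ⊢; omega) (by omega)
      le_rfl (by omega) (by omega) (by rw [hzY]; omega) (by omega) (by rw [hzY]; omega) (by omega) (by omega)
      (by omega)
  -- quasi-multiplicativity
  have qm1 : (μ[half]).real arm[x₀, F'] ≤ (μ[half]).real arm[x₀, F] * (μ[half]).real E[z₀, F + 2, F' - 1] :=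
    real_arm_le_mul hX hY hInj half hcX hcY (by omega) (by omega)
  have qm2 : ca * (μ[half]).real arm[x₀, 2 * F + 2] * (μ[half]).real E[z₀, F, F' + 1] ≤
      (μ[half]).real arm[x₀, F'] := by
    have := hglue x₀ z₀ (F + 1) F (2 * F + 2) (F' + 1) hx₀ hcX hcY (by push_cast at hF ⊢; omega) (by omega)
      (by omega) (by omega) (by omega) (by omega)
    rwa [add_sub_cancel_right] at this
  have qm3 : cx * (μ[half]).real arm[x₀, F] ≤ (μ[half]).real arm[x₀, 2 * F + 2] :=
    hxt x₀ F (2 * F + 2) hx₀ hx₁ (by push_cast at hF ⊢; omega) (by omega) (by omega)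
  have hC1 : 1 / ce ≤ max 1 (max (1 / ce) (1 / (ce * cx * ca))) := le_trans (le_max_left _ _) (le_max_right _ _)
  have hC2 : 1 / (ce * cx * ca) ≤ max 1 (max (1 / ce) (1 / (ce * cx * ca))) :=
    le_trans (le_max_right _ _) (le_max_right _ _)
  have nA : 0 ≤ (μ[half]).real arm[x₀, F] := measureReal_nonneg
  have nA' : 0 ≤ (μ[half]).real arm[x₀, F'] := measureReal_nonneg
  have nQ : 0 ≤ quadCrossingProb δ R := measureReal_nonneg
  constructor
  · -- upper half
    calc (μ[half]).real arm[x₀, F'] ≤ (μ[half]).real arm[x₀, F] * (μ[half]).real E[z₀, F + 2, F' - 1] := qm1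
      _ ≤ (μ[half]).real arm[x₀, F] * ((1 / ce) * quadCrossingProb δ R) := by
          refine mul_le_mul_of_nonneg_left ?_ nA
          rw [one_div, le_inv_mul_iff₀ hce]
          exact ext1.trans sa
      _ = (1 / ce) * (μ[half]).real arm[x₀, F] * quadCrossingProb δ R := by ring
      _ ≤ _ := by gcongr
  · -- lower half
    have step : (μ[half]).real arm[x₀, F] * quadCrossingProb δ R ≤
        (1 / (ce * cx * ca)) * (μ[half]).real arm[x₀, F'] := by
      rw [one_div, le_inv_mul_iff₀ (by positivity)]
      calc ce * cx * ca * ((μ[half]).real arm[x₀, F] * quadCrossingProb δ R)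
          = ca * (cx * (μ[half]).real arm[x₀, F]) * (ce * quadCrossingProb δ R) := by ring
        _ ≤ ca * (μ[half]).real arm[x₀, 2 * F + 2] * (μ[half]).real E[z₀, F, F' + 1] := by
            refine mul_le_mul (mul_le_mul_of_nonneg_left qm3 hca.le) ?_ (by positivity) (by positivity)
            exact (mul_le_mul_of_nonneg_left sb hce.le).trans ext2
        _ ≤ _ := qm2
    exact step.trans (mul_le_mul_of_nonneg_right hC2 nA')

end Chain

end HalfPlaneArm

end Literature.Probability.Percolation
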